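import Summits.RiemannHypothesis.RiemannHypothesis.Theorems.SoloInformedGroundStateEquation
import Literature.NumberTheory.LFunctions.WeilDilationVirialDeriv
import Literature.NumberTheory.LFunctions.WeilLogLatticeComb
import HarnessLib

/-!
# Pf-persistence index route (M2): negative definiteness of `Q` survives a small dilation

Long-odds MECHANISM SEARCH (cell `pub-rhpf`, seat M2); every result here is RH-free, unconditional,
and makes no claim about RH.  This file is the analytic kernel of `PfPersistenceM2ThresholdOpen`
(level sets of the window negative index are open rays; thresholds are not attained).

PROVED here (RH-free, unconditional), over the tree's Weil dictionary (`weilQuadratic`,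
`weilFunctional`, `weilConv`, `weilReflect`, Bombieri's dilation `weilDilate η g`):

* `weilQuadratic_sum_mul` — `Q(∑ cᵢ fᵢ) = ∑ᵢ ∑ⱼ cᵢ conj(cⱼ) W(fᵢ ⋆ f̃ⱼ)` for test functions and
  complex coefficients (bi-additivity of `g ⋆ h̃`, additivity of `W` on test kernels — tree facts;
  conjugate-homogeneity in the second slot is the tree's `weilCross_const_mul_right`);
* `re_weilQuadratic_sum_real_mul` — the polar expansion of `Re Q` over a finite REAL combination,
  `Re Q(∑ cᵢ fᵢ) = ½ ∑ᵢ ∑ⱼ cᵢ cⱼ (Re Q(fᵢ + fⱼ) - Re Q(fᵢ) - Re Q(fⱼ))`: the symmetrised polar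
  matrix is read off from the `n(n+1)/2` values `Q(fᵢ)`, `Q(fᵢ + fⱼ)`;
* `exists_pos_negDef_weilDilate` — **negative definiteness survives a small Bombieri dilation**:
  if `Re Q` is negative definite on the real span of `g₁, …, gₙ`, then for some `η > 0` it is
  negative definite on the span of the dilates `(gᵢ)_η(t) = (1+η)^{1/2} gᵢ((1+η)t)`, whose windows
  are SHORTER by the factor `1/(1+η)`.  The analytic input is the tree's virial theorem
  `hasDerivAt_re_weilQuadratic_weilDilate` [cite: Bombieri2000Weil, §4 proof of Thm 5 (the
  dilation `f_ε`)] (so `η ↦ Re Q(g_η)` is continuous at `0`), applied to the test functions `gᵢ`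
  and `gᵢ + gⱼ`; uniformity over coefficient vectors is compactness of the unit sphere of `ℝⁿ`
  plus homogeneity.
-/

noncomputable section

open Filter Set Metric
open scoped Topology ComplexConjugate

namespace Summit.RiemannHypothesis.RiemannHypothesis.Theorems.PfPersistenceM2NegIndex

open Literature.NumberTheory.LFunctions

/-! ## A. The polar form `W(g ⋆ h̃)` and the expansion of `Q` over finite combinations -/

/-- Additivity of the polar form `W(g ⋆ h̃)` in `g` (test functions). [cite: Bombieri2000Weil, §3 (the hermitian form attached to `T`)] -/
theorem weilFunctional_weilConv_weilReflect_add_left {g₁ g₂ h : ℝ → ℂ} (hg₁ : IsWeilTest g₁)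
    (hg₂ : IsWeilTest g₂) (hh : IsWeilTest h) :
    weilFunctional (weilConv (g₁ + g₂) (weilReflect h)) =
      weilFunctional (weilConv g₁ (weilReflect h)) + weilFunctional (weilConv g₂ (weilReflect h)) := by
  rw [weilConv_add_left hg₁ hg₂ hh.weilReflect,
    weilFunctional_add (hg₁.weilConv hh.weilReflect) (hg₂.weilConv hh.weilReflect)]

/-- Additivity of the polar form `W(g ⋆ h̃)` in `h` (test functions). [cite: Bombieri2000Weil, §3 (the hermitian form attached to `T`)] -/
theorem weilFunctional_weilConv_weilReflect_add_right {g h₁ h₂ : ℝ → ℂ} (hg : IsWeilTest g)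
    (hh₁ : IsWeilTest h₁) (hh₂ : IsWeilTest h₂) :
    weilFunctional (weilConv g (weilReflect (h₁ + h₂))) =
      weilFunctional (weilConv g (weilReflect h₁)) + weilFunctional (weilConv g (weilReflect h₂)) := by
  rw [weilReflect_add, weilConv_add_right hg hh₁.weilReflect hh₂.weilReflect,
    weilFunctional_add (hg.weilConv hh₁.weilReflect) (hg.weilConv hh₂.weilReflect)]

/-- Homogeneity of the polar form in `g`: `W((c g) ⋆ h̃) = c W(g ⋆ h̃)` (no hypotheses). [folklore] -/
theorem weilFunctional_weilConv_weilReflect_const_mul_left (c : ℂ) (g h : ℝ → ℂ) :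
    weilFunctional (weilConv (fun t ↦ c * g t) (weilReflect h)) =
      c * weilFunctional (weilConv g (weilReflect h)) := by
  rw [weilConv_const_mul_left]
  exact weilFunctional_const_mul c _

/-- The polar form over a finite combination in the first slot:
`W((∑ cᵢ fᵢ) ⋆ h̃) = ∑ cᵢ W(fᵢ ⋆ h̃)` (test functions). [folklore] -/
theorem weilFunctional_weilConv_weilReflect_sum_mul_left {ι : Type*} (s : Finset ι)
    {f : ι → ℝ → ℂ} (hf : ∀ i, IsWeilTest (f i)) (c : ι → ℂ) {h : ℝ → ℂ} (hh : IsWeilTest h) :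
    weilFunctional (weilConv (fun t ↦ ∑ i ∈ s, c i * f i t) (weilReflect h)) =
      ∑ i ∈ s, c i * weilFunctional (weilConv (f i) (weilReflect h)) := by
  classical
  induction s using Finset.induction_on with
  | empty =>
    have h0 := weilFunctional_weilConv_weilReflect_const_mul_left 0 h h
    simpa using h0
  | insert a s ha ih =>
    have hfs : IsWeilTest fun t ↦ ∑ i ∈ s, c i * f i t :=
      isWeilTest_finset_sum s fun i _ ↦ (hf i).const_mul (c i)
    have hsum : (fun t ↦ ∑ i ∈ insert a s, c i * f i t) =
        (fun t ↦ c a * f a t) + fun t ↦ ∑ i ∈ s, c i * f i t := by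
      funext t
      simp [Finset.sum_insert ha]
    rw [hsum, weilFunctional_weilConv_weilReflect_add_left ((hf a).const_mul (c a)) hfs hh, ih,
      weilFunctional_weilConv_weilReflect_const_mul_left, Finset.sum_insert ha]

/-- The polar form over a finite combination in the second slot:
`W(g ⋆ (∑ cᵢ fᵢ)̃) = ∑ conj cᵢ · W(g ⋆ f̃ᵢ)` (test functions). [folklore] -/
theorem weilFunctional_weilConv_weilReflect_sum_mul_right {ι : Type*} (s : Finset ι)
    {f : ι → ℝ → ℂ} (hf : ∀ i, IsWeilTest (f i)) (c : ι → ℂ) {g : ℝ → ℂ} (hg : IsWeilTest g) :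
    weilFunctional (weilConv g (weilReflect fun t ↦ ∑ i ∈ s, c i * f i t)) =
      ∑ i ∈ s, conj (c i) * weilFunctional (weilConv g (weilReflect (f i))) := by
  classical
  induction s using Finset.induction_on with
  | empty =>
    have h0 := weilCross_const_mul_right 0 g g
    simpa using h0
  | insert a s ha ih =>
    have hfs : IsWeilTest fun t ↦ ∑ i ∈ s, c i * f i t :=
      isWeilTest_finset_sum s fun i _ ↦ (hf i).const_mul (c i)
    have hsum : (fun t ↦ ∑ i ∈ insert a s, c i * f i t) =
        (fun t ↦ c a * f a t) + fun t ↦ ∑ i ∈ s, c i * f i t := by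
      funext t
      simp [Finset.sum_insert ha]
    rw [hsum, weilFunctional_weilConv_weilReflect_add_right hg ((hf a).const_mul (c a)) hfs, ih,
      weilCross_const_mul_right, Finset.sum_insert ha]

/-- **`Q` over a finite combination**: `Q(∑ cᵢ fᵢ) = ∑ᵢ ∑ⱼ cᵢ conj(cⱼ) W(fᵢ ⋆ f̃ⱼ)` for test
functions `fᵢ` and complex coefficients (`Q(g) = W(g ⋆ g̃)` is a hermitian form; Bombieri 2000
§3–4, Yoshida 1992 §2). [cite: Bombieri2000Weil, §3 (the hermitian form attached to `T`)] -/
theorem weilQuadratic_sum_mul {ι : Type*} (s : Finset ι) {f : ι → ℝ → ℂ}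
    (hf : ∀ i, IsWeilTest (f i)) (c : ι → ℂ) :
    weilQuadratic (fun t ↦ ∑ i ∈ s, c i * f i t) =
      ∑ i ∈ s, ∑ j ∈ s, c i * conj (c j) * weilFunctional (weilConv (f i) (weilReflect (f j))) := by
  have hfs : IsWeilTest fun t ↦ ∑ i ∈ s, c i * f i t :=
    isWeilTest_finset_sum s fun i _ ↦ (hf i).const_mul (c i)
  unfold weilQuadratic
  rw [weilFunctional_weilConv_weilReflect_sum_mul_left s hf c hfs]
  refine Finset.sum_congr rfl fun i _ ↦ ?_
  rw [weilFunctional_weilConv_weilReflect_sum_mul_right s hf c (hf i), Finset.mul_sum]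
  refine Finset.sum_congr rfl fun j _ ↦ ?_
  ring

/-- **Polar expansion of `Re Q` over a finite REAL combination of test functions**:
`Re Q(∑ cᵢ fᵢ) = ½ ∑ᵢ ∑ⱼ cᵢ cⱼ (Re Q(fᵢ + fⱼ) - Re Q(fᵢ) - Re Q(fⱼ))` — the symmetrised polar
matrix is read off from the `n(n+1)/2` values `Q(fᵢ)`, `Q(fᵢ + fⱼ)`. [folklore] -/
theorem re_weilQuadratic_sum_real_mul {ι : Type*} (s : Finset ι) {f : ι → ℝ → ℂ}
    (hf : ∀ i, IsWeilTest (f i)) (c : ι → ℝ) :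
    (weilQuadratic (fun t ↦ ∑ i ∈ s, (c i : ℂ) * f i t)).re =
      (1 / 2) * ∑ i ∈ s, ∑ j ∈ s, c i * c j *
        ((weilQuadratic (f i + f j)).re - (weilQuadratic (f i)).re - (weilQuadratic (f j)).re) := by
  have hpol : ∀ i j, (weilQuadratic (f i + f j)).re - (weilQuadratic (f i)).re -
      (weilQuadratic (f j)).re =
      (weilFunctional (weilConv (f i) (weilReflect (f j)))).re +
        (weilFunctional (weilConv (f j) (weilReflect (f i)))).re := by
    intro i j
    rw [weilQuadratic_add (hf i) (hf j)]
    simp only [Complex.add_re]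
    ring
  have hsymm : ∑ i ∈ s, ∑ j ∈ s, c i * c j * (weilFunctional (weilConv (f j) (weilReflect (f i)))).re =
      ∑ i ∈ s, ∑ j ∈ s, c i * c j * (weilFunctional (weilConv (f i) (weilReflect (f j)))).re := by
    rw [Finset.sum_comm]
    refine Finset.sum_congr rfl fun i _ ↦ Finset.sum_congr rfl fun j _ ↦ ?_
    ring
  calc (weilQuadratic (fun t ↦ ∑ i ∈ s, (c i : ℂ) * f i t)).re
      = ∑ i ∈ s, ∑ j ∈ s, c i * c j * (weilFunctional (weilConv (f i) (weilReflect (f j)))).re := by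
        rw [weilQuadratic_sum_mul s hf (fun i ↦ (c i : ℂ)), Complex.re_sum]
        refine Finset.sum_congr rfl fun i _ ↦ ?_
        rw [Complex.re_sum]
        refine Finset.sum_congr rfl fun j _ ↦ ?_
        rw [Complex.conj_ofReal, ← Complex.ofReal_mul, Complex.re_ofReal_mul]
    _ = (1 / 2) * ∑ i ∈ s, ∑ j ∈ s, c i * c j *
        ((weilQuadratic (f i + f j)).re - (weilQuadratic (f i)).re - (weilQuadratic (f j)).re) := by
        simp_rw [hpol, mul_add, Finset.sum_add_distrib]
        rw [hsymm]
        ring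

/-! ## B. Bombieri's dilation on finite families -/

/-- The dilation is additive. [folklore] -/
theorem weilDilate_add (η : ℝ) (g h : ℝ → ℂ) :
    weilDilate η (g + h) = weilDilate η g + weilDilate η h := by
  funext t
  simp [weilDilate_apply, mul_add]

/-- The dilation commutes with finite combinations. [folklore] -/
theorem weilDilate_sum_mul {ι : Type*} (s : Finset ι) (η : ℝ) (c : ι → ℂ) (f : ι → ℝ → ℂ) :
    weilDilate η (fun t ↦ ∑ i ∈ s, c i * f i t) = fun t ↦ ∑ i ∈ s, c i * weilDilate η (f i) t := by
  funext t
  simp only [weilDilate_apply, Finset.mul_sum]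
  refine Finset.sum_congr rfl fun i _ ↦ ?_
  ring

/-- The dilation preserves evenness. [folklore] -/
theorem weilDilate_even {g : ℝ → ℂ} (h : ∀ t : ℝ, g (-t) = g t) (η t : ℝ) :
    weilDilate η g (-t) = weilDilate η g t := by
  simp only [weilDilate_apply, mul_neg, h]

/-- The dilation preserves oddness. [folklore] -/
theorem weilDilate_odd {g : ℝ → ℂ} (h : ∀ t : ℝ, g (-t) = -g t) (η t : ℝ) :
    weilDilate η g (-t) = -weilDilate η g t := by
  simp only [weilDilate_apply, mul_neg, h]

/-- The dilation preserves real-valuedness. [folklore] -/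
theorem weilDilate_im_eq_zero {g : ℝ → ℂ} (h : ∀ t : ℝ, (g t).im = 0) (η t : ℝ) :
    (weilDilate η g t).im = 0 := by
  simp [weilDilate_apply, Complex.mul_im, h]

/-- `η ↦ Re Q(g_η)` is continuous at `η = 0` for every test function `g` (it is differentiable
there: the tree's virial theorem `hasDerivAt_re_weilQuadratic_weilDilate`).
[cite: Bombieri2000Weil, §4 proof of Thm 5 (the dilation `f_ε`)] -/
theorem continuousAt_re_weilQuadratic_weilDilate {g : ℝ → ℂ} (hg : IsWeilTest g) :
    ContinuousAt (fun η : ℝ ↦ (weilQuadratic (weilDilate η g)).re) 0 :=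
  (hasDerivAt_re_weilQuadratic_weilDilate hg).continuousAt

/-- **Negative definiteness survives a small dilation.**  If `Re Q` is negative definite on the
real span of the test functions `g₁, …, gₙ`, then for some `η > 0` it is negative definite on the
real span of the dilates `(g₁)_η, …, (gₙ)_η` (whose windows are shorter by the factor `1/(1+η)`).
Proof: the symmetrised polar matrix `N_η(i,j) = Re Q((gᵢ)_η + (gⱼ)_η) - Re Q((gᵢ)_η) - Re Q((gⱼ)_η)`
is entrywise continuous at `η = 0` (virial theorem for `gᵢ` and `gᵢ + gⱼ`), the form
`½ ∑ cᵢ cⱼ N_0(i,j) = Re Q(∑ cᵢ gᵢ)` has a negative maximum `-δ` on the unit sphere of `ℝⁿ`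
(compactness), and an entrywise error `< δ/(n²+1)` cannot undo it; homogeneity does the rest.
[folklore] -/
theorem exists_pos_negDef_weilDilate {n : ℕ} {g : Fin n → ℝ → ℂ} (hg : ∀ i, IsWeilTest (g i))
    (hneg : ∀ c : Fin n → ℝ, c ≠ 0 → (weilQuadratic (fun t : ℝ ↦ ∑ i, (c i : ℂ) * g i t)).re < 0) :
    ∃ η : ℝ, 0 < η ∧ ∀ c : Fin n → ℝ, c ≠ 0 →
      (weilQuadratic (fun t : ℝ ↦ ∑ i, (c i : ℂ) * weilDilate η (g i) t)).re < 0 := by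
  classical
  -- the symmetrised polar matrix along the dilation, and the quadratic form it defines
  set N : ℝ → Fin n → Fin n → ℝ := fun η i j ↦
    (weilQuadratic (weilDilate η (g i) + weilDilate η (g j))).re -
      (weilQuadratic (weilDilate η (g i))).re - (weilQuadratic (weilDilate η (g j))).re with hN
  set q : ℝ → (Fin n → ℝ) → ℝ := fun η c ↦ (1 / 2) * ∑ i, ∑ j, c i * c j * N η i j with hq
  -- (1) expansion of `Re Q` over the dilated family
  have hexp : ∀ η : ℝ, -1 < η → ∀ c : Fin n → ℝ,
      (weilQuadratic (fun t : ℝ ↦ ∑ i, (c i : ℂ) * weilDilate η (g i) t)).re = q η c := by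
    intro η hη c
    exact re_weilQuadratic_sum_real_mul Finset.univ (fun i ↦ (hg i).weilDilate hη) c
  -- (2) entrywise continuity at `η = 0`
  have hcont : ∀ i j, ContinuousAt (fun η ↦ N η i j) 0 := by
    intro i j
    have h1 : ContinuousAt (fun η : ℝ ↦ (weilQuadratic (weilDilate η (g i + g j))).re) 0 :=
      continuousAt_re_weilQuadratic_weilDilate ((hg i).add (hg j))
    have e : (fun η ↦ N η i j) = fun η ↦ (weilQuadratic (weilDilate η (g i + g j))).re -
        (weilQuadratic (weilDilate η (g i))).re - (weilQuadratic (weilDilate η (g j))).re := by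
      funext η
      simp only [hN, weilDilate_add]
    rw [e]
    exact (h1.sub (continuousAt_re_weilQuadratic_weilDilate (hg i))).sub
      (continuousAt_re_weilQuadratic_weilDilate (hg j))
  -- (3) homogeneity
  have hhom : ∀ (η r : ℝ) (c : Fin n → ℝ), q η (r • c) = r ^ 2 * q η c := by
    intro η r c
    simp only [hq, Pi.smul_apply, smul_eq_mul, Finset.mul_sum]
    refine Finset.sum_congr rfl fun i _ ↦ Finset.sum_congr rfl fun j _ ↦ ?_
    ring
  -- (4) negativity at `η = 0`
  have hq0 : ∀ c : Fin n → ℝ, c ≠ 0 → q 0 c < 0 := by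
    intro c hc
    rw [← hexp 0 (by norm_num) c]
    simpa only [weilDilate_zero] using hneg c hc
  -- the case `n = 0` is vacuous
  rcases Nat.eq_zero_or_pos n with rfl | hn
  · exact ⟨1, one_pos, fun c hc ↦ absurd (Subsingleton.elim c 0) hc⟩
  haveI : Nonempty (Fin n) := Fin.pos_iff_nonempty.1 hn
  -- (5) a uniform margin on the unit sphere of `ℝⁿ` (sup norm)
  have hS : IsCompact (sphere (0 : Fin n → ℝ) 1) := isCompact_sphere 0 1
  have hSne : (sphere (0 : Fin n → ℝ) 1).Nonempty := ⟨fun _ ↦ 1, by simp [pi_norm_const]⟩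
  have hq0cont : Continuous (q 0) := by
    show Continuous fun c : Fin n → ℝ ↦ (1 / 2) * ∑ i, ∑ j, c i * c j * N 0 i j
    exact continuous_const.mul (continuous_finsetSum _ fun i _ ↦ continuous_finsetSum _
      fun j _ ↦ ((continuous_apply i).mul (continuous_apply j)).mul continuous_const)
  obtain ⟨c₀, hc₀S, hmax⟩ := hS.exists_isMaxOn hSne hq0cont.continuousOn
  have hc₀ne : c₀ ≠ 0 := by
    have h1 : ‖c₀‖ = 1 := mem_sphere_zero_iff_norm.1 hc₀S
    intro h
    rw [h, norm_zero] at h1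
    exact zero_ne_one h1
  set δ : ℝ := -q 0 c₀ with hδ
  have hδpos : 0 < δ := by
    rw [hδ]
    exact neg_pos.2 (hq0 c₀ hc₀ne)
  -- (6) choose the dilation parameter
  set ε : ℝ := δ / ((n : ℝ) ^ 2 + 1) with hε
  have hεpos : 0 < ε := div_pos hδpos (by positivity)
  have hev : ∀ᶠ η in 𝓝 (0 : ℝ), ∀ i j, dist (N η i j) (N 0 i j) < ε := by
    refine eventually_all.2 fun i ↦ eventually_all.2 fun j ↦ ?_
    exact Metric.tendsto_nhds.1 (hcont i j).tendsto ε hεpos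
  obtain ⟨r, hrpos, hr⟩ := Metric.eventually_nhds_iff.1 hev
  have hr2 : ∀ i j, dist (N (r / 2) i j) (N 0 i j) < ε :=
    hr (by rw [Real.dist_eq, sub_zero, abs_of_pos (by positivity)]; linarith)
  refine ⟨r / 2, by positivity, fun c hc ↦ ?_⟩
  rw [hexp (r / 2) (by linarith) c]
  -- (7) the estimate on the unit sphere, then scale
  have hcnorm : 0 < ‖c‖ := norm_pos_iff.2 hc
  set u : Fin n → ℝ := ‖c‖⁻¹ • c with hu
  have huS : u ∈ sphere (0 : Fin n → ℝ) 1 := by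
    rw [mem_sphere_zero_iff_norm, hu, norm_smul, norm_inv, norm_norm, inv_mul_cancel₀ hcnorm.ne']
  have hcu : c = ‖c‖ • u := by
    rw [hu, smul_smul, mul_inv_cancel₀ hcnorm.ne', one_smul]
  have hui : ∀ i, |u i| ≤ 1 := fun i ↦ by
    have h1 := norm_le_pi_norm u i
    rw [mem_sphere_zero_iff_norm.1 huS, Real.norm_eq_abs] at h1
    exact h1
  have hdiff : |q (r / 2) u - q 0 u| ≤ (1 / 2) * ((n : ℝ) ^ 2 * ε) := by
    have hsub : q (r / 2) u - q 0 u =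
        (1 / 2) * ∑ i, ∑ j, u i * u j * (N (r / 2) i j - N 0 i j) := by
      simp only [hq]
      rw [← mul_sub, ← Finset.sum_sub_distrib]
      congr 1
      refine Finset.sum_congr rfl fun i _ ↦ ?_
      rw [← Finset.sum_sub_distrib]
      refine Finset.sum_congr rfl fun j _ ↦ ?_
      ring
    rw [hsub, abs_mul, abs_of_pos (by norm_num : (0 : ℝ) < 1 / 2)]
    refine mul_le_mul_of_nonneg_left ?_ (by norm_num)
    calc |∑ i, ∑ j, u i * u j * (N (r / 2) i j - N 0 i j)|
        ≤ ∑ i, |∑ j, u i * u j * (N (r / 2) i j - N 0 i j)| := Finset.abs_sum_le_sum_abs _ _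
      _ ≤ ∑ i, ∑ j, |u i * u j * (N (r / 2) i j - N 0 i j)| :=
          Finset.sum_le_sum fun i _ ↦ Finset.abs_sum_le_sum_abs _ _
      _ ≤ ∑ _i : Fin n, ∑ _j : Fin n, ε := by
          refine Finset.sum_le_sum fun i _ ↦ Finset.sum_le_sum fun j _ ↦ ?_
          rw [abs_mul, abs_mul]
          have h3 : |N (r / 2) i j - N 0 i j| < ε := by
            have h4 := hr2 i j
            rwa [Real.dist_eq] at h4
          calc |u i| * |u j| * |N (r / 2) i j - N 0 i j| ≤ 1 * 1 * ε :=
                mul_le_mul (mul_le_mul (hui i) (hui j) (abs_nonneg _) zero_le_one) h3.le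
                  (abs_nonneg _) (by norm_num)
            _ = ε := by ring
      _ = (n : ℝ) ^ 2 * ε := by
          simp only [Finset.sum_const, Finset.card_univ, Fintype.card_fin]
          ring
  have hqu : q (r / 2) u < 0 := by
    have hmax' : q 0 u ≤ q 0 c₀ := isMaxOn_iff.1 hmax u huS
    have h1 : q (r / 2) u ≤ q 0 u + (1 / 2) * ((n : ℝ) ^ 2 * ε) := by
      have h2 := (abs_le.1 hdiff).2
      linarith
    have h3 : (n : ℝ) ^ 2 * ε ≤ δ := by
      rw [hε, ← mul_div_assoc, div_le_iff₀ (by positivity : (0 : ℝ) < (n : ℝ) ^ 2 + 1)]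
      nlinarith
    have h4 : q 0 c₀ = -δ := by rw [hδ, neg_neg]
    linarith
  rw [hcu, hhom]
  exact mul_neg_of_pos_of_neg (by positivity) hqu

end Summit.RiemannHypothesis.RiemannHypothesis.Theorems.PfPersistenceM2NegIndex
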